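import Mathlib
import Literature.MathematicalPhysics.QuantumLattice.WilsonDiracAP
import Summits.QuantumFields.QCD.Theorems.WilsonQuarkChessboardFlatCellOptimalStubFreeTwistedFourierAllN

/-!
# The free antiperiodic Wilson determinant in closed form, `N` colours
(helper for crux stmt-QuantumFields-9307 `FlatCellOptimal`, line `registered`, stubs
`stub_hessianMarginAllN` / `stub_localNormGain_of`, sub-goal `stub_freeDetFormulaAllN` — the
`Fin 3 ↦ Fin N` port of the sibling crux stmt-QuantumFields-9734's
`…CriticalLineDiamagnetismStubFreeDetFormula`, gaps G2a/G4, wave 4)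

What.  For the FREE `r = 1` Wilson–Dirac operator on the four-torus `(ℤ/L)⁴` (colour `Fin N`, ANY
`N : ℕ`, spin `Fin 4`, bare mass `m`) with fermionic boundary conditions ANTIPERIODIC in all four
directions — the trivial `U(N)` field sign-twisted on the links leaving the last slice `x_μ = L - 1` in
their own direction — `‖det D_AP[1, m]‖² = ∏_k h_m(k)^{4N}`,
`h_m(k) = (m + Σ_μ (1 − cos θ_μ))² + Σ_μ sin² θ_μ`, `θ_μ = (2 k_μ + 1)π/L` (`stub_freeDetFormulaAllN`; the
sibling's `stub_freeDetFormula` is the case `N = 3`, exponent `12`).  The statement is the sibling's with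
`Fin 3 ↦ Fin N`, `12 ↦ 4 * N`, and with the `let dAP` turned into a universally quantified variable
`dAP : GaugeConfig → ℂ` at the fixed mass `m` with its defining equation (the shape of the crux's own
`let dAP` and of the skeleton's `dAP m`, both matched by `fun _ => rfl`), so that the registered
signature contains no `:=`.

How.  (1) SEAM ↔ PHASE, for every `N` and — as consumed downstream by the cell-determinant
factorisation — for an ARBITRARY `U(N)` field `X` (`gaugeTransform_phase_mul_eq_seam`): with the central
phase `ω = e^{iπ/L}·1 ∈ U(N)` (`phase_mem_unitaryGroup`, `phase_comm`) and the gauge function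
`s x := ω ^ (Σ_ν val x_ν)`, the gauge transform of `e ↦ ω X_e` by `s` is the seam-twisted field (off the
seam the scalar factor is `ω^{n+1} ω^{-(n+1)} = 1`, across it the exponent drops by `L - 1` and
`ω^L = e^{iπ} = -1`, `phase_pow`), so by gauge invariance of the fermion determinant
(`fermionDet_wilsonDirac_gaugeTransform`) `det D_AP[X, m] = det D[ω X, m]`
(`det_seam_eq_det_phase_mul`; `X = 1`: `gaugeTransform_phase_eq_seam`, `det_seam_eq_det_phase`).
(2) FOURIER, from the already ported colour-generic files `…FlatCellOptimalStubFreeTwistedFourier(Aux)AllN`: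
`D[ω] P = Q` for the unitary plane-wave matrix `P = F ⊗ 1_{N×4}` with the colour–spin symbol
`M(k) = (m + Σ(1 − cos φ_μ))·1 + iΣ sin φ_μ γ_μ` at the SHIFTED angles `φ_μ = 2π k_μ/L + π/L = θ_μ`
(`wilsonDirac_twist_mul_planeP`), the Clifford identity `M(k)ᴴ M(k) = h_m(k)·1`
(`clifford_conjTranspose_mul_self`) and `‖det A‖² = ∏_k d(k)^{4|n|}` (`norm_sq_det_of_planeWave`).
The `N`-free `ZMod`/shift bookkeeping lemmas of the sibling file are imported and re-EXPORTED into the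
namespace `…FreeBlocks.FreeDetFormula` (aliases, no restatement), so that downstream ports see the
sibling's names `FreeDetFormula.*` after `open …FlatCellOptimal.FreeBlocks`.

References: Montvay–Münster, *Quantum Fields on a Lattice* §4.2.4 (4.112)–(4.119) (antiperiodic Wilson
fermions in momentum space), §5.1.1 (5.3)–(5.5) (gauge invariance of the quark determinant); folklore.
Pure theorem file (no definitions).
-/

noncomputable section

open scoped BigOperators Classical Matrix ComplexConjugate
open Finset
open Literature.MathematicalPhysics.QuantumLattice Literature.MathematicalPhysics.QuantumFieldTheory
  Literature.Probability.LatticeModels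

namespace Summit.QuantumFields.QCD.Cruxes.FlatCellOptimal.FreeBlocks

open scoped Kronecker
open Complex (I)
open Summit.QuantumFields.QCD.Cruxes.FlatCellOptimal.FreeTwistedFourier

namespace FreeDetFormula

/-! ### `N`-free bookkeeping of the sibling file, re-exported (aliases) -/

export Summit.QuantumFields.QCD.Cruxes.CriticalLineDiamagnetism.ChessboardCellGain.FreeDetFormula
  (norm_sq_det_of_diag val_add_one_eq_iff zmod_val_neg_one zmod_val_add_one shift_apply_self
    shift_apply_of_ne)

export Summit.QuantumFields.QCD.Cruxes.FlatCellOptimal.FreeTwistedFourier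
  (norm_sq_det_of_planeWave planeP_conjTranspose_mul_self symQ_conjTranspose_mul_self_of)

/-! ### Seam ↔ phase: the antiperiodic seam is a gauge transform of the constant phase `e^{iπ/L}` -/

variable {N L : ℕ}

/-- A constant phase matrix `e^{iθ}·1` is unitary (`N` colours). -/
theorem exp_mul_I_smul_one_mem (θ : ℝ) :
    Complex.exp (↑θ * I) • (1 : Matrix (Fin N) (Fin N) ℂ) ∈ Matrix.unitaryGroup (Fin N) ℂ := by
  -- adapted from the sibling `FreeDetFormula.phase_mem_unitaryGroup` (`Fin 3 ↦ Fin N`, textual)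
  refine Unitary.smul_mem_of_mem ?_ (one_mem _)
  rw [Unitary.mem_iff, Complex.star_def, Complex.conj_mul', Complex.mul_conj',
    Complex.norm_exp_ofReal_mul_I]
  simp

/-- The constant phase matrix `e^{iπ/L}·1` is unitary (`N` colours). -/
theorem phase_mem_unitaryGroup (L : ℕ) :
    Complex.exp (↑(Real.pi / L) * I) • (1 : Matrix (Fin N) (Fin N) ℂ) ∈
      Matrix.unitaryGroup (Fin N) ℂ :=
  exp_mul_I_smul_one_mem (Real.pi / L)

/-- A scalar unitary matrix is central in `U(N)`. -/
theorem phase_comm {c : ℂ} {ω : Matrix.unitaryGroup (Fin N) ℂ}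
    (hω : (ω : Matrix (Fin N) (Fin N) ℂ) = c • (1 : Matrix (Fin N) (Fin N) ℂ))
    (u : Matrix.unitaryGroup (Fin N) ℂ) : Commute ω u := by
  -- adapted from `CellDetFactorisation.phase_comm` (stmt-QuantumFields-9734; `Fin 3 ↦ Fin N`)
  rw [Commute, SemiconjBy]
  apply Subtype.ext
  change (ω : Matrix (Fin N) (Fin N) ℂ) * u = u * ω
  rw [hω, smul_mul_assoc, one_mul, mul_smul_comm, mul_one]

variable [NeZero L]

/-- `ω ^ L = -1` for `ω = e^{iπ/L}·1 ∈ U(N)`: `(e^{iπ/L})^L = e^{iπ} = -1`. -/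
theorem phase_pow {ω : Matrix.unitaryGroup (Fin N) ℂ}
    (hω : (ω : Matrix (Fin N) (Fin N) ℂ) =
      Complex.exp (↑(Real.pi / L) * I) • (1 : Matrix (Fin N) (Fin N) ℂ)) :
    ω ^ L = -1 := by
  -- adapted from the sibling `FreeDetFormula.phase_pow` (`Fin 3 ↦ Fin N`, textual)
  apply Subtype.ext
  have hL : (L : ℂ) ≠ 0 := Nat.cast_ne_zero.2 (NeZero.ne L)
  have harg : (L : ℂ) * (↑(Real.pi / L) * I) = Real.pi * I := by
    rw [Complex.ofReal_div, Complex.ofReal_natCast]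
    field_simp
  rw [SubmonoidClass.coe_pow, hω, smul_pow, one_pow, ← Complex.exp_nat_mul, harg,
    Complex.exp_pi_mul_I, Unitary.coe_neg, OneMemClass.coe_one, neg_smul, one_smul]

/-- **Seam ↔ phase for an arbitrary `U(N)` field `X`.**  With `s x := ω ^ (Σ_ν val x_ν)`,
`ω = e^{iπ/L}·1`, the gauge transform of `e ↦ ω X_e` by `s` is the seam-twisted field: `ω` is central,
off the seam the scalar factor is `ω^{n+1} (ω^{n+1})⁻¹ = 1`, on the seam `val x_μ + 1 = L` the exponent
drops by `L - 1` and the factor is `ω^L = -1`. -/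
theorem gaugeTransform_phase_mul_eq_seam {ω : Matrix.unitaryGroup (Fin N) ℂ}
    (hω : (ω : Matrix (Fin N) (Fin N) ℂ) =
      Complex.exp (↑(Real.pi / L) * I) • (1 : Matrix (Fin N) (Fin N) ℂ))
    (X : GaugeConfig 4 L (Matrix.unitaryGroup (Fin N) ℂ)) :
    gaugeTransform (fun x : Site 4 L => ω ^ (∑ ν, (x ν).val)) (fun e => ω * X e) =
      fun e : Edge 4 L => if (e.1 e.2).val + 1 = L then -X e else X e := by
  -- adapted from `FreeDetFormula.gaugeTransform_phase_eq_seam` and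
  -- `CellDetFactorisation.gaugeTransform_phase_mul_eq_seam` (stmt-QuantumFields-9734; `Fin 3 ↦ Fin N`)
  funext ⟨x, μ⟩
  simp only [gaugeTransform]
  have hx : ∑ ν, (x ν).val = (x μ).val + ∑ ν ∈ Finset.univ.erase μ, (x ν).val :=
    (Finset.add_sum_erase _ _ (Finset.mem_univ μ)).symm
  have hxs : ∑ ν, (Site.shift x μ ν).val = (x μ + 1).val + ∑ ν ∈ Finset.univ.erase μ, (x ν).val := by
    rw [← Finset.add_sum_erase _ _ (Finset.mem_univ μ), shift_apply_self]
    congr 1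
    exact Finset.sum_congr rfl fun ν hν => by rw [shift_apply_of_ne x (Finset.ne_of_mem_erase hν)]
  rw [hx, hxs]
  set n := ∑ ν ∈ Finset.univ.erase μ, (x ν).val with hn
  have hre : ω ^ ((x μ).val + n) * (ω * X (x, μ)) * (ω ^ ((x μ + 1).val + n))⁻¹ =
      ω ^ ((x μ).val + n + 1) * (ω ^ ((x μ + 1).val + n))⁻¹ * X (x, μ) := by
    rw [← mul_assoc (ω ^ _) ω, ← pow_succ, mul_assoc, mul_assoc,
      (((phase_comm hω (X (x, μ))).pow_left _).inv_left).eq]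
  rw [hre]
  by_cases h : (x μ).val + 1 = L
  · have h' : x μ = -1 := (val_add_one_eq_iff _).1 h
    have hL1 : 1 ≤ L := NeZero.one_le
    rw [if_pos h, h', neg_add_cancel, ZMod.val_zero, zero_add, zmod_val_neg_one,
      show L - 1 + n + 1 = L + n by omega, pow_add, mul_inv_cancel_right, phase_pow hω, neg_one_mul]
  · have h' : x μ ≠ -1 := fun h'' => h ((val_add_one_eq_iff _).2 h'')
    rw [if_neg h, zmod_val_add_one h', add_right_comm (x μ).val n 1, mul_inv_cancel, one_mul]

/-- **Seam ↔ phase** (`X = 1`): the gauge transform of the CONSTANT field `ω = e^{iπ/L}·1` by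
`s x := ω ^ (Σ_ν val x_ν)` is the antiperiodic seam field (`-1` on the seam, `+1` off it). -/
theorem gaugeTransform_phase_eq_seam {ω : Matrix.unitaryGroup (Fin N) ℂ}
    (hω : (ω : Matrix (Fin N) (Fin N) ℂ) =
      Complex.exp (↑(Real.pi / L) * I) • (1 : Matrix (Fin N) (Fin N) ℂ)) :
    gaugeTransform (fun x : Site 4 L => ω ^ (∑ ν, (x ν).val)) (fun _ : Edge 4 L => ω) =
      fun e : Edge 4 L => if (e.1 e.2).val + 1 = L then (-1 : Matrix.unitaryGroup (Fin N) ℂ) else 1 := by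
  have h := gaugeTransform_phase_mul_eq_seam hω (1 : GaugeConfig 4 L (Matrix.unitaryGroup (Fin N) ℂ))
  simp only [Pi.one_apply, mul_one] at h
  exact h

/-- **Seam ↔ phase for the determinant of an arbitrary field**: `det D_AP[X, m] = det D[ω X, m]`,
`ω = e^{iπ/L}·1` (gauge invariance of the Wilson fermion determinant). -/
theorem det_seam_eq_det_phase_mul (m : ℝ) {ω : Matrix.unitaryGroup (Fin N) ℂ}
    (hω : (ω : Matrix (Fin N) (Fin N) ℂ) =
      Complex.exp (↑(Real.pi / L) * I) • (1 : Matrix (Fin N) (Fin N) ℂ))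
    (X : GaugeConfig 4 L (Matrix.unitaryGroup (Fin N) ℂ)) :
    (wilsonDirac (unitaryFundamentalRep (Fin N) ℂ)
        (fun e : Edge 4 L => if (e.1 e.2).val + 1 = L then -X e else X e) m 1).det =
      (wilsonDirac (unitaryFundamentalRep (Fin N) ℂ) (fun e : Edge 4 L => ω * X e) m 1).det := by
  have h := fermionDet_wilsonDirac_gaugeTransform (unitaryFundamentalRep (Fin N) ℂ)
    (fun x : Site 4 L => ω ^ (∑ ν, (x ν).val)) (fun e : Edge 4 L => ω * X e) m 1
  rw [gaugeTransform_phase_mul_eq_seam hω X] at h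
  exact h

/-- **Seam ↔ phase for the free determinant**: `det D_AP[1, m] = det D[ω, m]`, `ω = e^{iπ/L}·1`. -/
theorem det_seam_eq_det_phase (m : ℝ) {ω : Matrix.unitaryGroup (Fin N) ℂ}
    (hω : (ω : Matrix (Fin N) (Fin N) ℂ) =
      Complex.exp (↑(Real.pi / L) * I) • (1 : Matrix (Fin N) (Fin N) ℂ)) :
    (wilsonDirac (unitaryFundamentalRep (Fin N) ℂ)
        (fun e : Edge 4 L => if (e.1 e.2).val + 1 = L then (-1 : Matrix.unitaryGroup (Fin N) ℂ) else 1)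
        m 1).det =
      (wilsonDirac (unitaryFundamentalRep (Fin N) ℂ) (fun _ : Edge 4 L => ω) m 1).det := by
  have h := fermionDet_wilsonDirac_gaugeTransform (unitaryFundamentalRep (Fin N) ℂ)
    (fun x : Site 4 L => ω ^ (∑ ν, (x ν).val)) (fun _ : Edge 4 L => ω) m 1
  rw [gaugeTransform_phase_eq_seam hω] at h
  exact h

/-! ### The twisted free determinant in closed form -/

/-- **`‖det D[ω, m]‖²` for the constant phase `ω = e^{iπ/L}·1 ∈ U(N)`**:
`∏_k ((m + Σ_μ (1 − cos θ_μ))² + Σ_μ sin² θ_μ)^{4N}`, `θ_μ = (2 val k_μ + 1)π/L` (plane-wave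
diagonalisation at the shifted angles `2π k_μ/L + π/L = θ_μ`, Clifford identity, `4N` colour–spin
components per momentum). -/
theorem norm_sq_det_phase (m : ℝ) {ω : Matrix.unitaryGroup (Fin N) ℂ}
    (hω : (ω : Matrix (Fin N) (Fin N) ℂ) =
      Complex.exp (↑(Real.pi / L) * I) • (1 : Matrix (Fin N) (Fin N) ℂ)) :
    ‖(wilsonDirac (unitaryFundamentalRep (Fin N) ℂ) (fun _ : Edge 4 L => ω) m 1).det‖ ^ 2 =
      ∏ k : Site 4 L,
        ((m + ∑ μ : Fin 4, (1 - Real.cos ((2 * ((k μ).val : ℝ) + 1) * Real.pi / L))) ^ 2 +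
            ∑ μ : Fin 4, Real.sin ((2 * ((k μ).val : ℝ) + 1) * Real.pi / L) ^ 2) ^ (4 * N) := by
  -- adapted from the sibling `stub_freeDetFormula` (`Fin 3 ↦ Fin N`, `12 ↦ 4 * N`)
  have hS : ∀ k : TorusSite 4 L,
      ((((m + ∑ μ, (1 - Real.cos (2 * Real.pi * ((k μ).val : ℝ) / L + Real.pi / L))) : ℝ) : ℂ) •
            (1 : Matrix (Fin 4) (Fin 4) ℂ) +
          I • ∑ μ, ((Real.sin (2 * Real.pi * ((k μ).val : ℝ) / L + Real.pi / L) : ℝ) : ℂ) •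
            euclideanGamma μ)ᴴ *
        ((((m + ∑ μ, (1 - Real.cos (2 * Real.pi * ((k μ).val : ℝ) / L + Real.pi / L))) : ℝ) : ℂ) •
            (1 : Matrix (Fin 4) (Fin 4) ℂ) +
          I • ∑ μ, ((Real.sin (2 * Real.pi * ((k μ).val : ℝ) / L + Real.pi / L) : ℝ) : ℂ) •
            euclideanGamma μ) =
      (((m + ∑ μ, (1 - Real.cos (2 * Real.pi * ((k μ).val : ℝ) / L + Real.pi / L))) ^ 2 +
          ∑ μ, Real.sin (2 * Real.pi * ((k μ).val : ℝ) / L + Real.pi / L) ^ 2 : ℝ) : ℂ) •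
        (1 : Matrix (Fin 4) (Fin 4) ℂ) :=
    fun k => clifford_conjTranspose_mul_self _ _
  have hA := wilsonDirac_twist_mul_planeP (L := L) (Real.pi / L) m ω hω
  have hθ : ∀ v : ℝ, 2 * Real.pi * v / L + Real.pi / L = (2 * v + 1) * Real.pi / L := fun v => by ring
  have h1 := norm_sq_det_of_planeWave _ _ hS _ hA
  rw [Fintype.card_fin] at h1
  rw [h1]
  refine Finset.prod_congr rfl fun k _ => ?_
  simp only [hθ]

end FreeDetFormula

open FreeDetFormula

/-- **The free antiperiodic Wilson determinant in closed form, `N` colours** (sub-goal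
`stub_freeDetFormulaAllN`): for the trivial `U(N)` field with the antiperiodic seam (sign `-1` on the
links leaving the slice `val x_μ = L - 1` in direction `μ`, all four directions), bare mass `m`, `r = 1`,
and `dAP` the seam determinant at mass `m` given by its defining equation,
`‖dAP 1‖² = ∏_k ((m + Σ_μ (1 − cos θ_μ))² + Σ_μ sin² θ_μ)^{4N}`, `θ_μ = (2 val k_μ + 1)π/L`
(seam ↔ constant phase `e^{iπ/L}` by a gauge transformation, then plane-wave diagonalisation). -/
theorem stub_freeDetFormulaAllN : ∀ (N L : ℕ) [NeZero L] (m : ℝ) (dAP : GaugeConfig 4 L (Matrix.unitaryGroup (Fin N) ℂ) → ℂ), (∀ V, dAP V = (wilsonDirac (unitaryFundamentalRep (Fin N) ℂ) (fun e => if (e.1 e.2).val + 1 = L then -V e else V e) m 1).det) → ‖dAP 1‖ ^ 2 = ∏ k : Site 4 L, ((m + ∑ μ : Fin 4, (1 - Real.cos ((2 * ((k μ).val : ℝ) + 1) * Real.pi / L))) ^ 2 + ∑ μ : Fin 4, Real.sin ((2 * ((k μ).val : ℝ) + 1) * Real.pi / L) ^ 2) ^ (4 * N) := by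
  intro N L _ m dAP hdAP
  rw [hdAP]
  simp only [Pi.one_apply]
  set ω : Matrix.unitaryGroup (Fin N) ℂ := ⟨_, phase_mem_unitaryGroup L⟩ with hωdef
  have hω : (ω : Matrix (Fin N) (Fin N) ℂ) =
      Complex.exp (↑(Real.pi / L) * I) • (1 : Matrix (Fin N) (Fin N) ℂ) := rfl
  rw [det_seam_eq_det_phase m hω]
  exact norm_sq_det_phase m hω

end Summit.QuantumFields.QCD.Cruxes.FlatCellOptimal.FreeBlocks

end
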